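import Summits.SmoothPoincare4.SmoothPoincare4.Theses.LegendrianSphereS7
import HarnessLib

/-!
# Line `birth` — BC3 skeleton for the crux `LegendrianSphereS7.ExactLagrangianHomotopySpheres` (stmt-SmoothPoincare4-4230)

Route `route-SmoothPoincare4-LegendrianSphereS7` (rank-3 crux, the "flexibility half" `A`), decl
`Summit.SmoothPoincare4.SmoothPoincare4.Theses.LegendrianSphereS7.ExactLagrangianHomotopySpheres`:

  every homotopy 4-sphere `Σ` (`Literature.Topology.FourManifolds.HomotopySphere 4`) admits an exact
  Lagrangian embedding into `(T*S⁴, λ_can)`, in the route's model `T*S⁴ = TS⁴ = {(q,p) ∈ ℝ⁵ × ℝ⁵ :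
  ‖q‖ = 1, ⟪q,p⟫ = 0}`, `λ = ⟪p, dq⟫`: smooth `q p : Σ → ℝ⁵`, `g : Σ → ℝ` with `‖q‖ = 1`, `⟪q,p⟫ = 0`,
  `(q,p)` an injective immersion, `dg = ⟪p, Dq·⟫`.

Standing of the crux (item notes 2026-08-15/16: route review, five crux attacks, grounder): OPEN — the
`n = 4` case of the Ekholm–Kragh–Smith / Abouzaid question "which homotopy spheres are Lagrangian in
`T*Sⁿ`"; `SmoothPoincare4 → A` is machine-checked in the refuters' evidence (zero section), the
converse is known only through the route's conditional `NearbyLagrangianSphereFour`; dropping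
INJECTIVITY from the clause makes it a theorem (Gromov–Lees h-principle; explicitly the hodograph lift
below), so "all content of `A` is double-point removal" (refuter rattack-11281).  No `Disproof.lean`, no
crux workfiles, no `Theorems/ExactLagrangianHomotopySpheres/Negative/*`, negatives index empty
(`ledger crux ls stmt-SmoothPoincare4-4230`, `ledger negatives --problem SmoothPoincare4`, 2026-08-17).

## The line: cusp-free fronts — the hodograph (Legendre) lift of a chord-free hypersurface immersion `Σ ↬ ℝ⁵`

The HODOGRAPH TRANSFORMATION identifies the contact manifold of co-oriented contact elements of `ℝ⁵`
(pairs `(f, ν)`, `‖ν‖ = 1`, contact form `⟪ν, df⟫`; Arnold 1989 App. 4 §§D, K) with the 1-jet space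
`J¹(S⁴) = T*S⁴ × ℝ` (contact form `dz − ⟪p, dq⟫`) by
`(f, ν) ↦ (q, p, z) = (ν, f − ⟪f,ν⟫ν, ⟪f,ν⟫)` — indeed `dz − ⟪p,dq⟫ = ⟪df,ν⟫ + ⟪f,dν⟫ − ⟪f,dν⟫ +
⟪f,ν⟫⟪ν,dν⟫ = ⟪ν, df⟫`.  Hence a LEGENDRE PAIR `(f, ν) : M⁴ → ℝ⁵ × S⁴` (`⟪df, ν⟫ = 0`, `(f,ν)` an
immersion — Cecil 2013 Thm 4.2, eq. (4.41) for hypersurfaces of Euclidean space) is carried to a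
Legendrian of `J¹(S⁴)` whose Lagrangian projection `Φ_(f,ν) = (ν, f − ⟪f,ν⟫ν) : M → TS⁴` is an EXACT
LAGRANGIAN IMMERSION with primitive the support function `h = ⟪f, ν⟫` (`Φ*⟪p,dq⟫ = ⟪f, dν⟫ = dh`), based
on the Gauss map `q = ν`; it is injective iff `(f, ν)` has NO CONORMAL CHORD: no `x ≠ y` with
`ν x = ν y` and `f y − f x ∈ ℝ·ν` (equal tangential projections).  Conversely EVERY exact Lagrangian
immersion `(q, p)` with primitive `g` is `Φ_(f,ν)` for the Legendre pair `f = p + g q`, `ν = q`, so on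
ALL Legendre pairs the reformulation is a tautology; the line restricts to CUSP-FREE fronts, i.e. `f`
itself an immersed hypersurface with Gauss map `ν`, where the search space is the classical one of
hypersurface immersions `Σ⁴ ↬ ℝ⁵` (non-empty: every homotopy 4-sphere even EMBEDS in `ℝ⁵`, being the
boundary of a contractible 5-manifold whose double is `S⁵` — Kervaire–Milnor 1963 / Smale) and the
defect is a finite, algebraically-zero configuration: for generic `f` the double points of `Φ_f` are
isolated conormal-chord pairs whose signed count is `([S⁴]² − e(ν_Φ))/2 = (2 − 2)/2 = 0` (Whitney /
Lashof–Smale; `deg ν = χ(Σ)/2 = 1`, Hopf).  So the crux splits as the BRIDGE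

  `ExactLagrangianHomotopySpheres ⇐ ChordFreeHypersurface ∧ (hodograph lift is exact Lagrangian)`,

with an OPEN geometric-topological leaf (no symplectic word in it) and a KNOWN elementary leaf (no
homotopy sphere in it):

* `stub_chordFreeHypersurface` — **OPEN (the bet):** every homotopy 4-sphere `Σ` admits a smooth
  immersion `f : Σ ↬ ℝ⁵` with a smooth unit normal field `ν` (`‖ν‖ = 1`, `⟪Df·, ν⟫ = 0`) and no
  conormal chord: `ν x = ν y ∧ f x − ⟪f x, ν x⟫ν x = f y − ⟪f y, ν y⟫ν y ⇒ x = y`.  Implied by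
  `SmoothPoincare4` (round `S⁴ ⊂ ℝ⁵`, `f = ν = id`, `ν` injective); implies the crux (this file); NOT
  cheaply equivalent to it (a general exact Lagrangian `Σ ⊂ T*S⁴` has a front `p + g q` WITH cusps, and
  no cusp-cancellation for closed exact Lagrangians is known); not known to imply `SmoothPoincare4`
  (that needs the route's conditional B, `NearbyLagrangianSphereFour`, restricted to cusp-free fronts:
  "an immersed closed hypersurface of `ℝ⁵` homotopy equivalent to `S⁴` with injective hodograph map is
  standard" — true e.g. for convex hypersurfaces, Hadamard).  Why it might fail: for an exotic `Σ` the
  cancelling conormal-chord pairs of a generic `f` may be un-cancellable through hypersurface regular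
  homotopies — a Lagrangian Whitney-trick problem (rigid side: Lagrangian surgery changes topology;
  EkholmSmith2016 rigidity of one-double-point immersions in `ℂⁿ`, `n ≥ 6` even); and with the smooth
  nearby Lagrangian conjecture the stub is FALSE at every exotic `Σ` — exactly like the crux, a
  refutation `¬stub(Σ)` exhibits an exotic `S⁴`.  Sources: Arnold1989 (App. 4), Cecil2013 (Thm 4.2,
  (4.41)), Gromov1986/Lees1976 (h-principle for exact Lagrangian immersions), Hirsch1959, Whitney1944,
  EkholmEliashbergMurphySmith2013, EkholmSmith2016, refuter note rattack-11281 on this item ("prover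
  hint: `A(Σ) ⇐ Σ` immerses in `ℝ⁵` without normal chords").  Size: open problem.
* `stub_hodographLift` — **KNOWN (classical, elementary; M–L to formalise):** for ANY `C^∞` 4-manifold
  `M` (charts on `ℝ⁴`) and any Legendre pair `(f, ν) : M → ℝ⁵ × ℝ⁵` — `f, ν` smooth, `‖ν‖ = 1`,
  `⟪Df v, ν⟫ = 0`, `ker Df ∩ ker Dν = 0` — the hodograph data `q = ν`, `p = f − ⟪f,ν⟫ν`, `h = ⟪f,ν⟫`
  satisfy the crux clause except injectivity: `p`, `h` smooth; `⟪ν, p⟫ = 0`; `ker Dν ∩ ker Dp = 0`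
  (on `ker Dν`: `Dp v = Df v − ⟪Df v,ν⟫ν − ⟪f,Dν v⟫ν − ⟪f,ν⟫Dν v = Df v`); `dh = ⟪p, Dν·⟫`
  (`dh v = ⟪Df v, ν⟫ + ⟪f, Dν v⟫ = ⟪f, Dν v⟫ = ⟪p, Dν v⟫ + ⟪f,ν⟫⟪ν, Dν v⟫`, and `⟪ν, Dν v⟫ = 0` from
  `‖ν‖ = 1`).  No homotopy-sphere, compactness or injectivity hypothesis.  Why it might fail: it does
  not (three-line computation in print); formalisation cost only (`mfderiv` product rules for `inner` /
  `smul` on a manifold source: `MDifferentiableAt.smul`, `ContMDiff.smul`, `ContMDiff.inner`, chart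
  reduction `MDifferentiableAt.mfderiv`).  Sources: Arnold1989 App. 4 §K (Legendre submanifolds of the
  manifold of contact elements, fronts), Cecil2013 Thm 4.2 + eq. (4.41) (Legendre lift of `(F, η)`,
  support function `F·η`), McDuffSalamon2017 §3.4 (exact Lagrangian immersions), refuter rattack-11281.
* `ExactLagrangianHomotopySpheres_of : ExactLagrangianHomotopySpheres` — THE skeleton theorem: the crux
  BY NAME from the two declared stubs (the only `sorry`s of the file); pure logic: the chord-free
  hypothesis of stub 1 is verbatim the injectivity conjunct of the crux at `(ν, p)`, stub 2 supplies the
  other six conjuncts.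

What this line adds to the summit's implication graph: the edge `ChordFreeHypersurface ⇒ A (4230)` —
a second, C-independent entrance to the crux (the route's own plan reaches `A` only through the harder
crux `CotangentLiouvilleEquivalence` (4231) and the glue item `CotangentToLagrangian` (4232)); and a new
refutation target: `¬ChordFreeHypersurface(Σ)` for an explicit `Σ` is WEAKER than `¬A(Σ)` and still
certifies `Σ` exotic (`SmoothPoincare4 ⇒ stub 1`).

BC3 probes (planner folder `bc/probe_stub1.lean`, `bc/probe_stub2.lean`, 2026-08-17): for each stub,
`stub → ExactLagrangianHomotopySpheres` and `stub → SmoothPoincare4` by `first | exact? | simpa | aesop`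
FAIL (stub 1 has no `p`, `g`; stub 2 has no homotopy sphere; no landed theorem links either to the crux
or the summit).  Converse directions for the record: `SmoothPoincare4 ⇒ stub 1` (true: round sphere;
M-sized in Lean via `range_mfderiv_coe_sphere`, `mfderiv_coe_sphere_injective`), `stub 2` is a theorem.
Disproof used: none exists for this crux.  Negatives index: empty for SmoothPoincare4 — neither stub is
an instance of a refuted statement.
-/

noncomputable section

open scoped Manifold ContDiff Topology ContinuousMap InnerProductSpace
open Summit.SmoothPoincare4.SmoothPoincare4.Theses.LegendrianSphereS7 (ExactLagrangianHomotopySpheres)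

-- `Summit.<Summit>.<Problem>`: for the single-conjunct summit the duplicate segment is mandated.
set_option linter.dupNamespace false
set_option linter.unusedVariables false

namespace Summit.SmoothPoincare4.SmoothPoincare4.Cruxes.ExactLagrangianHomotopySpheres.Birth

/-! ## The two registered stubs (`sorry` lives ONLY here) -/

/-- **Stub 1 (OPEN — the bet): every homotopy 4-sphere admits a chord-free co-oriented hypersurface
immersion into `ℝ⁵`.**  For every `S : HomotopySphere 4` there are smooth `f ν : S.carrier → ℝ⁵` with
`‖ν‖ = 1`, `⟪Df v, ν⟫ = 0` (`ν` is a Gauss map of `f`), `f` an immersion (`Df v = 0 ⇒ v = 0`: the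
front is CUSP-FREE), and NO CONORMAL CHORD: `ν x = ν y` and `f x − ⟪f x, ν x⟫ν x = f y − ⟪f y, ν y⟫ν y`
force `x = y` — i.e. the hodograph map `x ↦ (ν x, f x − ⟪f x, ν x⟫ν x) ∈ TS⁴` is injective.
Implied by `SmoothPoincare4` (round sphere, `f = ν` injective); implies the crux via
`stub_hodographLift`; not known either way for an exotic `Σ` (generic `f` has finitely many conormal-chord
pairs of total sign `0`; cancelling them through hypersurfaces is a Lagrangian Whitney-trick problem).
Why it might fail: rigidity of closed exact Lagrangians (no h-principle; EkholmSmith2016-type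
one-double-point rigidity) — and under the smooth nearby Lagrangian conjecture it fails at every exotic
`Σ`, so `¬stub(Σ)` is an exoticness certificate, never a cheap refutation.
[cite: Arnold1989, App. 4 §K] [cite: Cecil2013, Thm 4.2, (4.41)] [cite: Gromov1986, 2.4.3]
[cite: EkholmEliashbergMurphySmith2013] [cite: EkholmSmith2016] -/
theorem stub_chordFreeHypersurface :
    ∀ S : Literature.Topology.FourManifolds.HomotopySphere 4, ∃ (f ν : S.carrier → EuclideanSpace ℝ (Fin 5)), ContMDiff (𝓡 4) 𝓘(ℝ, EuclideanSpace ℝ (Fin 5)) ∞ f ∧ ContMDiff (𝓡 4) 𝓘(ℝ, EuclideanSpace ℝ (Fin 5)) ∞ ν ∧ (∀ x, ‖ν x‖ = 1) ∧ (∀ x (v : TangentSpace (𝓡 4) x), ⟪ν x, mfderiv (𝓡 4) 𝓘(ℝ, EuclideanSpace ℝ (Fin 5)) f x v⟫_ℝ = 0) ∧ (∀ x (v : TangentSpace (𝓡 4) x), mfderiv (𝓡 4) 𝓘(ℝ, EuclideanSpace ℝ (Fin 5)) f x v = 0 → v = 0) ∧ (∀ x y, ν x = ν y → f x - ⟪f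 x, ν x⟫_ℝ • ν x = f y - ⟪f y, ν y⟫_ℝ • ν y → x = y) := by
  sorry

/-- **Stub 2 (KNOWN, classical — the hodograph / Legendre lift of a co-oriented hypersurface is an exact
Lagrangian immersion into `T*S⁴` based on the Gauss map).**  For any `C^∞` 4-manifold `M` and any
LEGENDRE PAIR `(f, ν) : M → ℝ⁵ × ℝ⁵` — `f, ν` smooth, `‖ν‖ = 1`, `⟪Df v, ν⟫ = 0`, `ker Df ∩ ker Dν = 0`
(Cecil 2013 Thm 4.2: scalar-product, contact and immersion conditions) — the hodograph data
`q = ν`, `p = f − ⟪f,ν⟫ν`, `h = ⟪f,ν⟫` (support function) satisfy: `p` and `h` are smooth; `⟪ν, p⟫ = 0`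
(so `(ν, p) ∈ TS⁴ = {‖q‖ = 1, ⟪q,p⟫ = 0}`); `ker Dν ∩ ker Dp = 0` (on `ker Dν`, `Dp v = Df v`); and
EXACTNESS `dh = ⟪p, Dν·⟫` (`dh v = ⟪Df v,ν⟫ + ⟪f,Dν v⟫ = ⟪f, Dν v⟫`, `⟪ν, Dν v⟫ = 0`).  This is the
statement that the hodograph contactomorphism `(f,ν) ↦ (ν, f − ⟪f,ν⟫ν, ⟪f,ν⟫)` from co-oriented contact
elements of `ℝ⁵` (`α = ⟪ν, df⟫`) to `J¹(S⁴)` (`α = dz − ⟪p,dq⟫`) carries Legendrians to Legendrians,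
written out in the route's `TS⁴ ⊂ ℝ⁵ × ℝ⁵` model; no homotopy-sphere, compactness or injectivity
hypothesis.  Why it might fail: it does not — a three-line computation; formalisation only
(`MDifferentiableAt.smul`, `ContMDiff.smul`, `ContMDiff.inner`, `MDifferentiableAt.mfderiv`).
[cite: Arnold1989, App. 4 §§D, K] [cite: Cecil2013, Thm 4.2, (4.41)] [cite: McDuffSalamon2017, §3.4] -/
theorem stub_hodographLift :
    ∀ (M : Type) [TopologicalSpace M] [ChartedSpace (EuclideanSpace ℝ (Fin 4)) M] [IsManifold (𝓡 4) ∞ M] (f ν : M → EuclideanSpace ℝ (Fin 5)), ContMDiff (𝓡 4) 𝓘(ℝ, EuclideanSpace ℝ (Fin 5)) ∞ f → ContMDiff (𝓡 4) 𝓘(ℝ, EuclideanSpace ℝ (Fin 5)) ∞ ν → (∀ x, ‖ν x‖ = 1) → (∀ x (v : TangentSpace (𝓡 4) x), ⟪ν x, mfderiv (𝓡 4) 𝓘(ℝ, EuclideanSpace ℝ (Fin 5)) f x v⟫_ℝ = 0) → (∀ x (v : TangentSpace (𝓡 4) x), mfderiv (𝓡 4) 𝓘(ℝ, EuclideanSpace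 ℝ (Fin 5)) f x v = 0 → mfderiv (𝓡 4) 𝓘(ℝ, EuclideanSpace ℝ (Fin 5)) ν x v = 0 → v = 0) → ContMDiff (𝓡 4) 𝓘(ℝ, EuclideanSpace ℝ (Fin 5)) ∞ (fun x => f x - ⟪f x, ν x⟫_ℝ • ν x) ∧ ContMDiff (𝓡 4) 𝓘(ℝ, ℝ) ∞ (fun x => ⟪f x, ν x⟫_ℝ) ∧ (∀ x, ⟪ν x, f x - ⟪f x, ν x⟫_ℝ • ν x⟫_ℝ = 0) ∧ (∀ x (v : TangentSpace (𝓡 4) x), mfderiv (𝓡 4) 𝓘(ℝ, EuclideanSpace ℝ (Fin 5)) ν x v = 0 → mfderiv (𝓡 4) 𝓘(ℝ, EuclideanSpace ℝ (Fin 5)) (fun x => f x - ⟪f x, ν x⟫_ℝ • ν x) x v = 0 → v = 0) ∧ (∀ x (v : TangentSpace (𝓡 4) x), mfderiv (𝓡 4) 𝓘(ℝ, ℝ) (fun x => ⟪f x, ν x⟫_ℝ) x v = ⟪f x - ⟪f x, ν x⟫_ℝ • ν x, mfderiv (𝓡 4) 𝓘(ℝ, EuclideanSpace ℝ (Fin 5))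 ν x v⟫_ℝ) := by
  sorry

/-! ## The composition: the two stubs prove the crux BY NAME (no `sorry` below this line) -/

/-- **Composition with explicit hypotheses** (the BC3 shape `stub₁-sig → stub₂-sig → crux`, stated
pointwise in the homotopy sphere so that `ExactLagrangianHomotopySpheres_of` is the only theorem of this
file concluding the crux by name): a chord-free co-oriented immersion `(f, ν)` of `S.carrier` (stub 1)
has an exact Lagrangian hodograph lift `(ν, f − ⟪f,ν⟫ν, ⟪f,ν⟫)` (stub 2), whose injectivity is the
chord-freeness.  Pure logic. [cite: Arnold1989, App. 4 §K] [cite: Cecil2013, Thm 4.2] -/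
theorem exactLagrangian_of_stubs
    (hCF : ∀ S : Literature.Topology.FourManifolds.HomotopySphere 4, ∃ (f ν : S.carrier → EuclideanSpace ℝ (Fin 5)), ContMDiff (𝓡 4) 𝓘(ℝ, EuclideanSpace ℝ (Fin 5)) ∞ f ∧ ContMDiff (𝓡 4) 𝓘(ℝ, EuclideanSpace ℝ (Fin 5)) ∞ ν ∧ (∀ x, ‖ν x‖ = 1) ∧ (∀ x (v : TangentSpace (𝓡 4) x), ⟪ν x, mfderiv (𝓡 4) 𝓘(ℝ, EuclideanSpace ℝ (Fin 5)) f x v⟫_ℝ = 0) ∧ (∀ x (v : TangentSpace (𝓡 4) x), mfderiv (𝓡 4) 𝓘(ℝ, EuclideanSpace ℝ (Fin 5)) f x v = 0 → v = 0) ∧ (∀ x y, ν x = ν y → f x - ⟪f x, ν x⟫_ℝ • ν x = f y - ⟪f y, ν y⟫_ℝ • ν y → x = y))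
    (hHL : ∀ (M : Type) [TopologicalSpace M] [ChartedSpace (EuclideanSpace ℝ (Fin 4)) M] [IsManifold (𝓡 4) ∞ M] (f ν : M → EuclideanSpace ℝ (Fin 5)), ContMDiff (𝓡 4) 𝓘(ℝ, EuclideanSpace ℝ (Fin 5)) ∞ f → ContMDiff (𝓡 4) 𝓘(ℝ, EuclideanSpace ℝ (Fin 5)) ∞ ν → (∀ x, ‖ν x‖ = 1) → (∀ x (v : TangentSpace (𝓡 4) x), ⟪ν x, mfderiv (𝓡 4) 𝓘(ℝ, EuclideanSpace ℝ (Fin 5)) f x v⟫_ℝ = 0) → (∀ x (v : TangentSpace (𝓡 4) x), mfderiv (𝓡 4) 𝓘(ℝ, EuclideanSpace ℝ (Fin 5)) f x v = 0 → mfderiv (𝓡 4) 𝓘(ℝ, EuclideanSpace ℝ (Fin 5)) ν x v = 0 → v = 0) → ContMDiff (𝓡 4) 𝓘(ℝ, EuclideanSpace ℝ (Fin 5)) ∞ (fun x => f x - ⟪f x, ν x⟫_ℝ • ν x) ∧ ContMDiff (𝓡 4) 𝓘(ℝ, ℝ) ∞ (fun x => ⟪f x, ν x⟫_ℝ) ∧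 (∀ x, ⟪ν x, f x - ⟪f x, ν x⟫_ℝ • ν x⟫_ℝ = 0) ∧ (∀ x (v : TangentSpace (𝓡 4) x), mfderiv (𝓡 4) 𝓘(ℝ, EuclideanSpace ℝ (Fin 5)) ν x v = 0 → mfderiv (𝓡 4) 𝓘(ℝ, EuclideanSpace ℝ (Fin 5)) (fun x => f x - ⟪f x, ν x⟫_ℝ • ν x) x v = 0 → v = 0) ∧ (∀ x (v : TangentSpace (𝓡 4) x), mfderiv (𝓡 4) 𝓘(ℝ, ℝ) (fun x => ⟪f x, ν x⟫_ℝ) x v = ⟪f x - ⟪f x, ν x⟫_ℝ • ν x, mfderiv (𝓡 4) 𝓘(ℝ, EuclideanSpace ℝ (Fin 5)) ν x v⟫_ℝ))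
    (S : Literature.Topology.FourManifolds.HomotopySphere 4) :
    ∃ (q p : S.carrier → EuclideanSpace ℝ (Fin 5)) (g : S.carrier → ℝ), ContMDiff (𝓡 4) 𝓘(ℝ, EuclideanSpace ℝ (Fin 5)) ∞ q ∧ ContMDiff (𝓡 4) 𝓘(ℝ, EuclideanSpace ℝ (Fin 5)) ∞ p ∧ ContMDiff (𝓡 4) 𝓘(ℝ, ℝ) ∞ g ∧ (∀ x, ‖q x‖ = 1 ∧ ⟪q x, p x⟫_ℝ = 0) ∧ (∀ x y, q x = q y → p x = p y → x = y) ∧ (∀ x (v : TangentSpace (𝓡 4) x), mfderiv (𝓡 4) 𝓘(ℝ, EuclideanSpace ℝ (Fin 5)) q x v = 0 → mfderiv (𝓡 4) 𝓘(ℝ, EuclideanSpace ℝ (Fin 5)) p x v = 0 → v = 0) ∧ (∀ x (v : TangentSpace (𝓡 4) x), mfderiv (𝓡 4) 𝓘(ℝ, ℝ) g x v = ⟪p x, mfderiv (𝓡 4) 𝓘(ℝ, EuclideanSpace ℝ (Fin 5)) q x v⟫_ℝ) := by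
  -- stub 1: a chord-free co-oriented hypersurface immersion `(f, ν)` of the homotopy sphere
  obtain ⟨f, ν, hf, hν, hunit, hnormal, himm, hchord⟩ := hCF S
  -- `f` an immersion ⇒ the Legendre pair `(f, ν)` is an immersion (Cecil's condition (2))
  have himm' : ∀ x (v : TangentSpace (𝓡 4) x),
      mfderiv (𝓡 4) 𝓘(ℝ, EuclideanSpace ℝ (Fin 5)) f x v = 0 →
        mfderiv (𝓡 4) 𝓘(ℝ, EuclideanSpace ℝ (Fin 5)) ν x v = 0 → v = 0 :=
    fun x v h _ => himm x v h
  -- stub 2: the hodograph lift `(ν, f − ⟪f,ν⟫ν, ⟪f,ν⟫)` is an exact Lagrangian immersion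
  obtain ⟨hp, hg, horth, himmΦ, hex⟩ := hHL S.carrier f ν hf hν hunit hnormal himm'
  exact ⟨ν, fun x => f x - ⟪f x, ν x⟫_ℝ • ν x, fun x => ⟪f x, ν x⟫_ℝ, hν, hp, hg,
    fun x => ⟨hunit x, horth x⟩, hchord, himmΦ, hex⟩

/-- **THE SKELETON THEOREM.** The crux
`Summit.SmoothPoincare4.SmoothPoincare4.Theses.LegendrianSphereS7.ExactLagrangianHomotopySpheres`,
concluded BY NAME from the two DECLARED stubs `stub_chordFreeHypersurface`, `stub_hodographLift` (the
only `sorry`s of the file) through the sorry-free composition `exactLagrangian_of_stubs`.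
[cite: Arnold1989, App. 4 §K] [cite: Cecil2013, Thm 4.2] -/
theorem ExactLagrangianHomotopySpheres_of : ExactLagrangianHomotopySpheres := by
  intro S
  exact exactLagrangian_of_stubs stub_chordFreeHypersurface stub_hodographLift S

end Summit.SmoothPoincare4.SmoothPoincare4.Cruxes.ExactLagrangianHomotopySpheres.Birth

end
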